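import Mathlib
import Summits.PneNP.PneNP.Theorems.SymmetryBudgetHamCompilesStubRref
import Summits.PneNP.PneNP.Theorems.SymmetryBudgetHamCompilesFDagSem

/-!
# Wire values of the F-side DAG, part 1: subspace bookkeeping and the span identities
# (stub `stub_symmetricF`, obligation `stub_symmetricF_wires`; line `kotzig-cutspan`,
# crux `SymmetryBudget.HamCompiles`, stmt-PneNP-10637)

The F-side DAG of `SymmetryBudgetHamCompilesFDag.lean` carries every subspace of the span
recursion as its reduced echelon table; `SymmetryBudgetHamCompilesFDagSem.lean` assigns to every
gate its intended value `fsem` as explicit mathematics. This auxiliary file of the obligation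
`stub_symmetricF_wires : SymF.WireVals m x` (proved in `SymmetryBudgetHamCompilesFWires.lean`)
supplies the SUBSPACE-level facts:

* decoding of margin code words (`dOf_sbCode`, `dOf_cminus`: injectivity of the stars-and-bars
  code, `sbCode_injOn`);
* the towers at their full node are the states of the recursion (`TS_ot`, `TS_ct`: the DP
  identities `Ospan_eq`, `Cspan_eq`, the inner accumulations re-indexed by rank pairs);
* the one-row table of the line `span {𝟙}` (`rrefRow_span_one`, the hard-wired `C(∅, 0)`) and
  the zero table of `⊥` (`rrefRow_bot`);
* the span identities, clauses 8–9 of `WireVals` (`span_yvec`, `CH_N_eq`): the vectors inserted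
  by a chain span exactly its term (rows of a reduced table span the subspace,
  `span_range_rrefRow`; masks are linear maps, `Submodule.span_image`), so every chain ends at
  `left ⊔ term`; and the inner accumulator steps (`IS_succ`, `CH_inner_N`).

All auxiliary lemmas live in the sub-namespace `SymF.Wires`; the file closes with the registered
sub-goal `stub_symmetricF_wires_span` (clause 9).
-/

-- `Summit.PneNP.PneNP.…` duplicates `PneNP` BY DESIGN (single-problem summit, D-0017).
set_option linter.dupNamespace false

noncomputable section

namespace Summit.PneNP.PneNP.Theorems.HamCompilesKC

open Literature.Computability.Complexity
open Finset

namespace SymF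

namespace Wires

variable {m : ℕ} (x : Fin m × Fin m → Bool)

/-! ### Decoding margin code words -/

/-- The decoded margins have total mass `≤ 2g`. -/
theorem dOf_mass_le (e : Cd m) : (∑ t, dOf e t) ≤ 2 * gOf m := by
  unfold dOf
  split_ifs with h
  · exact (Classical.choose_spec h).1
  · simp

/-- Decoding a code word (injectivity of the stars-and-bars code, `sbCode_injOn`). -/
theorem dOf_sbCode (d : Fin (gOf m) → ℕ) (hd : (∑ t, d t) ≤ 2 * gOf m) :
    dOf (m := m) (sbCode d) = d := by
  have h : ∃ d' : Fin (gOf m) → ℕ, (∑ t, d' t) ≤ 2 * gOf m ∧ sbCode d' = sbCode d :=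
    ⟨d, hd, rfl⟩
  unfold dOf
  rw [dif_pos h]
  exact sbCode_injOn (Classical.choose_spec h).1 hd (Classical.choose_spec h).2

/-- The predecessor code decodes to the predecessor margins `dOf e - δ i - δ j`. -/
theorem dOf_cminus (e : Cd m) (i j : Fin (gOf m)) :
    dOf (cminus e i j) = dOf e - δ i - δ j := by
  apply dOf_sbCode
  refine le_trans (Finset.sum_le_sum fun t _ => ?_) (dOf_mass_le e)
  simp only [Pi.sub_apply]
  omega

/-! ### The subspaces carried by the towers -/

/-- An open state at a vertex outside its set is `⊥`. -/
theorem OS_of_not_mem {P : PSet m} {t : Fin m} (ht : t ∉ P.1) (i : Fin (gOf m)) (e : Cd m) :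
    OS m x P t i e = ⊥ := by
  unfold OS
  rw [Ospan_eq, if_neg ht]

/-- At the empty node a tower is its base. -/
theorem TS_empty (τ : TCtx m) (B : PSet m) (hB : B.1 = ∅) : TS m x τ B = baseSub m x τ := by
  unfold TS
  rw [hB]
  simp

/-- The base of a closed tower is `⊥`. -/
theorem baseSub_ct (P : PSet m) (e : Cd m) : baseSub m x (.ct P e) = ⊥ := rfl

/-- **The open tower at its full node is the open state** (the DP identity `Ospan_eq`). -/
theorem TS_ot {P : PSet m} {t : Fin m} (ht : t ∈ P.1) (i : Fin (gOf m)) (e : Cd m) :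
    TS m x (.ot P t i e) (P.erase t) = OS m x P t i e := by
  unfold TS OS
  rw [Ospan_eq, if_pos ht]
  simp only [PSet.erase]
  congr 1
  · simp only [baseSub, gsub, CS, PSet.erase]
    by_cases h : rk m x t = (i : ℕ)
    · rw [if_pos ⟨h, ht⟩, if_pos h]
    · rw [if_neg fun h' => h h'.1, if_neg h]
  · refine iSup_congr fun w => iSup_congr fun _ => ?_
    simp only [termSub, gsub, OS, PSet.erase]
    by_cases h : (Gr m x).Adj w t
    · rw [if_pos ⟨h, ht⟩, if_pos h]
    · rw [if_neg fun h' => h h'.1, if_neg h]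

/-- The full inner accumulator is the supremum of all inner terms. -/
theorem IS_full (P : PSet m) (e : Cd m) (t : Fin m) :
    IS m x P e t (gOf m * gOf m) = ⨆ r, innerTerm m x P e t r := by
  unfold IS
  exact iSup_congr fun r => iSup_pos r.2

/-- Re-indexing a supremum over `Fin (g * g)` by rank pairs. -/
theorem iSup_fin_prod {α : Type*} [CompleteLattice α] (G : Fin (gOf m * gOf m) → α) :
    (⨆ r, G r) = ⨆ i : Fin (gOf m), ⨆ j : Fin (gOf m), G (finProdFinEquiv (i, j)) := by
  apply le_antisymm
  · refine iSup_le fun r => ?_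
    have hr : G r =
        G (finProdFinEquiv ((finProdFinEquiv.symm r).1, (finProdFinEquiv.symm r).2)) := by
      rw [Prod.mk.eta, Equiv.apply_symm_apply]
    rw [hr]
    exact le_trans (le_iSup (fun j => G (finProdFinEquiv ((finProdFinEquiv.symm r).1, j))) _)
      (le_iSup (fun i => ⨆ j, G (finProdFinEquiv (i, j))) _)
  · exact iSup_le fun i => iSup_le fun j => le_iSup G _

/-- **The closed tower at its full node is the closed state** (the DP identity `Cspan_eq`, the
inner accumulations re-indexed by rank pairs, the predecessor codes decoded by `dOf_cminus`). -/
theorem TS_ct {P : PSet m} (hP : P.1.Nonempty) (e : Cd m) :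
    TS m x (.ct P e) P = CS m x P e := by
  unfold TS CS
  rw [Cspan_eq m x hP, baseSub_ct, bot_sup_eq]
  refine iSup_congr fun t => iSup_congr fun _ => ?_
  show IS m x P e t (gOf m * gOf m) = _
  rw [IS_full, iSup_fin_prod]
  refine iSup_congr fun i => iSup_congr fun j => ?_
  have hpr : pr (m := m) (finProdFinEquiv (i, j)) = (i, j) := Equiv.symm_apply_apply _ _
  unfold innerTerm gsub MGuard OS
  rw [hpr]
  dsimp only
  rw [dOf_cminus]

/-! ### The zero table of `⊥`; the one-row table of `span {𝟙}` (the hard-wired `C(∅, 0)`) -/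

/-- The bottom subspace has the zero table. -/
theorem rrefRow_bot {g : ℕ} (c : Fin g → Bool) :
    rrefRow (⊥ : Submodule (ZMod 2) (Vec g)) c = 0 := by
  apply rrefRow_of_not_isPivot
  rintro ⟨w, hw, hw1, -⟩
  rw [(Submodule.mem_bot (R := ZMod 2)).1 hw] at hw1
  exact zero_ne_one hw1

/-- `skey` vanishes only at the empty indicator. -/
theorem skey_eq_zero_iff {g : ℕ} (c : Fin g → Bool) : skey c = 0 ↔ c = fun _ => false := by
  constructor
  · intro h
    funext i
    have hi := (Finset.sum_eq_zero_iff.1 h) i (Finset.mem_univ i)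
    by_contra hc
    rw [if_pos (by simpa using hc)] at hi
    exact absurd hi (Nat.two_pow_pos _).ne'
  · rintro rfl
    simp [skey]

/-- The pivots of `span {𝟙}`: only the empty indicator. -/
theorem isPivot_span_one_iff {g : ℕ} (p : Fin g → Bool) :
    IsPivot (Submodule.span (ZMod 2) {(fun _ => (1 : ZMod 2) : Vec g)}) p ↔
      p = fun _ => false := by
  have h0 : skey (fun _ : Fin g => false) = 0 := (skey_eq_zero_iff _).2 rfl
  constructor
  · rintro ⟨w, hw, hw1, hwlt⟩
    by_contra hp
    have hsk : skey (fun _ : Fin g => false) < skey p := by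
      rw [h0]
      exact Nat.pos_of_ne_zero fun h => hp ((skey_eq_zero_iff p).1 h)
    obtain ⟨a, rfl⟩ := Submodule.mem_span_singleton.1 hw
    have h1 := hwlt _ hsk
    simp only [Pi.smul_apply, smul_eq_mul, mul_one] at h1 hw1
    exact zero_ne_one (h1.symm.trans hw1)
  · rintro rfl
    refine ⟨fun _ => 1, Submodule.mem_span_singleton_self _, rfl, fun c' hc' => ?_⟩
    rw [h0] at hc'
    exact absurd hc' (Nat.not_lt_zero _)

/-- **The table of the line spanned by the all-ones vector**: a single all-ones row at the empty
indicator. -/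
theorem rrefRow_span_one {g : ℕ} (c c' : Fin g → Bool) :
    rrefRow (Submodule.span (ZMod 2) {(fun _ => (1 : ZMod 2) : Vec g)}) c c' =
      if c = (fun _ => false) then 1 else 0 := by
  have h0 : skey (fun _ : Fin g => false) = 0 := (skey_eq_zero_iff _).2 rfl
  have htab : (fun p : Fin g → Bool =>
      if p = (fun _ => false) then (fun _ => (1 : ZMod 2) : Vec g) else 0) =
      rrefRow (Submodule.span (ZMod 2) {(fun _ => (1 : ZMod 2) : Vec g)}) := by
    apply rrefRow_eq_of
    · intro p hp
      rw [isPivot_span_one_iff] at hp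
      subst hp
      rw [if_pos rfl]
      refine ⟨Submodule.mem_span_singleton_self _, rfl, fun c'' hc'' => ?_, fun q hq hqc => ?_⟩
      · rw [h0] at hc''
        exact absurd hc'' (Nat.not_lt_zero _)
      · exact absurd ((isPivot_span_one_iff q).1 hq) hqc
    · intro p hp
      rw [isPivot_span_one_iff] at hp
      rw [if_neg hp]
  rw [← htab]
  by_cases hc : c = fun _ => false
  · subst hc
    simp
  · simp [hc]

/-! ### The span identities (clauses 8–9) -/

/-- Rows of a table re-indexed by the coordinate enumeration `kc` still span the subspace. -/
theorem span_range_rrefRow_kc (W : Submodule (ZMod 2) (Vec (gOf m))) :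
    Submodule.span (ZMod 2) (Set.range fun k : Fin (N m) => rrefRow W (kc k)) = W := by
  have h : (Set.range fun k : Fin (N m) => rrefRow W (kc k)) = Set.range (rrefRow W) := by
    ext v
    constructor
    · rintro ⟨k, rfl⟩
      exact ⟨kc k, rfl⟩
    · rintro ⟨c, rfl⟩
      exact ⟨boolVecEquiv (gOf m) c, by simp [kc]⟩
  rw [h, span_range_rrefRow]

/-- **Clause 8: the vectors inserted by a chain span exactly its term.** -/
theorem span_yvec (χ : ChCtx m) :
    Submodule.span (ZMod 2) (Set.range (yvec m x χ)) = chainTerm m x χ := by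
  rcases χ with ⟨τ, B, w⟩ | ⟨P, e, t, r⟩
  · rcases τ with ⟨P, t, i, e⟩ | ⟨P, e⟩
    · show _ = termSub m x (.ot P t i e) w
      simp only [termSub, gsub]
      by_cases hp : (Gr m x).Adj w t ∧ t ∈ P.1
      · rw [if_pos hp]
        have hy : yvec m x (.tw (.ot P t i e) B w) =
            fun k => rrefRow (OS m x (P.erase t) w i e) (kc k) := by
          funext k
          simp only [yvec]
          rw [if_pos hp]
        rw [hy, span_range_rrefRow_kc]
      · rw [if_neg hp, Submodule.span_eq_bot]
        rintro v ⟨k, rfl⟩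
        simp only [yvec]
        rw [if_neg hp]
    · exact span_range_rrefRow_kc _
  · show _ = innerTerm m x P e t r
    simp only [innerTerm, gsub]
    by_cases hq : rk m x t = ((pr r).2 : ℕ) ∧ MGuard e (pr r).1 (pr r).2
    · rw [if_pos hq]
      have hy : yvec m x (.inner P e t r) =
          ⇑(mulLin (maskVec (pr r).1 (pr r).2)) ∘ fun k =>
            rrefRow (OS m x P t (pr r).1 (cminus e (pr r).1 (pr r).2)) (kc k) := by
        funext k
        funext c'
        show yvec m x (.inner P e t r) k c' =
          maskVec (pr r).1 (pr r).2 c' *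
            rrefRow (OS m x P t (pr r).1 (cminus e (pr r).1 (pr r).2)) (kc k) c'
        simp only [yvec, maskVec]
        by_cases hc : c' (pr r).1 = c' (pr r).2
        · rw [if_pos ⟨hc, hq.2, hq.1⟩, if_pos hc, one_mul]
        · rw [if_neg fun h => hc h.1, if_neg hc, zero_mul]
      rw [hy, Set.range_comp, Submodule.span_image, span_range_rrefRow_kc]
      rfl
    · rw [if_neg hq, Submodule.span_eq_bot]
      rintro v ⟨k, rfl⟩
      funext c'
      simp only [yvec, Pi.zero_apply]
      rw [if_neg]
      rintro ⟨-, h1, h2⟩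
      exact hq ⟨h2, h1⟩

/-- The chain subspace after all `N` insertions contains every inserted vector. -/
theorem CH_N (χ : ChCtx m) :
    CH m x χ (N m) = leftSub m x χ ⊔ Submodule.span (ZMod 2) (Set.range (yvec m x χ)) := by
  have hS : {v | ∃ k' : Fin (N m), (k' : ℕ) < N m ∧ v = yvec m x χ k'} =
      Set.range (yvec m x χ) := by
    ext v
    simp only [Set.mem_setOf_eq, Set.mem_range, Fin.is_lt, true_and]
    constructor
    · rintro ⟨k, rfl⟩
      exact ⟨k, rfl⟩
    · rintro ⟨k, rfl⟩
      exact ⟨k, rfl⟩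
  unfold CH
  rw [hS]

/-- **Clause 9: a chain ends at `left ⊔ term`.** -/
theorem CH_N_eq (χ : ChCtx m) : CH m x χ (N m) = leftSub m x χ ⊔ chainTerm m x χ := by
  rw [CH_N, span_yvec]

/-- Before any insertion the chain subspace is the left subspace. -/
theorem CH_zero (χ : ChCtx m) : CH m x χ 0 = leftSub m x χ := by
  unfold CH
  simp

/-! ### The inner accumulators (clause 3) -/

/-- `Acc_0 = ⊥`. -/
theorem IS_zero (P : PSet m) (e : Cd m) (t : Fin m) : IS m x P e t 0 = ⊥ := by
  simp [IS]

/-- `Acc_{r+1} = Acc_r ⊔ innerTerm r`. -/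
theorem IS_succ (P : PSet m) (e : Cd m) (t : Fin m) (r : Fin (gOf m * gOf m)) :
    IS m x P e t ((r : ℕ) + 1) = IS m x P e t r ⊔ innerTerm m x P e t r := by
  unfold IS
  have h : ∀ r' : Fin (gOf m * gOf m),
      ((r' : ℕ) < (r : ℕ) + 1) ↔ ((r' : ℕ) < r ∨ r' = r) := fun r' => by
    rw [Nat.lt_succ_iff_lt_or_eq, Fin.val_inj]
  simp_rw [h, iSup_or, iSup_sup_eq, iSup_iSup_eq_left]

/-- The chain of the `r`-th inner accumulation step ends at `Acc_{r+1}`. -/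
theorem CH_inner_N (P : PSet m) (e : Cd m) (t : Fin m) (r : Fin (gOf m * gOf m)) :
    CH m x (.inner P e t r) (N m) = IS m x P e t ((r : ℕ) + 1) := by
  rw [CH_N_eq, IS_succ]
  rfl

end Wires

end SymF

/-- Registered sub-goal of `stub_symmetricF_wires` served by this file (`--supports
stmt-PneNP-10637`): clause 9 of `SymF.WireVals` — every chain of the F-side DAG ends at
`left ⊔ term` (`SymF.Wires.CH_N_eq`). -/
theorem stub_symmetricF_wires_span (m : ℕ) (x : Fin m × Fin m → Bool) (χ : SymF.ChCtx m) :
    SymF.CH m x χ (SymF.N m) = SymF.leftSub m x χ ⊔ SymF.chainTerm m x χ :=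
  SymF.Wires.CH_N_eq x χ

end Summit.PneNP.PneNP.Theorems.HamCompilesKC
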